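import Summits.CriticalPhenomena.SAWScalingLimit.Theorems.SAWCompassLatticeCompassSLEYbLatticeSimple

/-!
# Subsequential limits of Glazman–Manolescu's `π/2` Yang–Baxter walk are carried by the closure of
# the simple curves (the SOFT half of stub I2b of crux `CompassSLE`, stmt-CriticalPhenomena-6965,
# line `registered` = `birth`, lead c6; file 3 of 3)

* `map_ybLaw_simple_eq` — for `a ≠ b`, `δ ≠ 0` the pushed-forward Yang–Baxter law gives the event
  `CurveClass.simple` full mass (`LatticeSimple.curve_mem_simple`);
* `subseqLimit_closure_simple` / registered piece **`stub_ybSubseqLimitClosureSimple`** — every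
  probability subsequential weak limit `ν`, along mesh sequences `s_n → 0⁺`, of the curve laws of
  GM's critical `π/2` walk in a Dobrushin domain (any port endpoint approximation) satisfies
  `ν(closure CurveClass.simple) = 1` (portmanteau on a closed set of eventual lattice probability
  one). What is left of the open stub I2b `stub_ybSubseqLimitSimple` is exactly
  `ν(closure simple ∖ simple) = 0` — no self-touching of the limit, the uniform no-fjord estimate.

References: P. Billingsley, *Convergence of Probability Measures* (1999), Thm. 2.1 (portmanteau);
M. Aizenman, A. Burchard, Duke Math. J. 99 (1999), §2.1. No named fact is used.
-/

noncomputable section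

namespace Summit.CriticalPhenomena.SAWScalingLimit.Theorems.SAWCompassLatticeCompassSLE

open MeasureTheory Filter Topology Set Metric
open scoped NNReal ENNReal unitInterval
open Literature.Probability.RandomPlanarGeometry

namespace LatticeSimple

/-! ### The law: every sample curve is simple; subsequential limits are carried by the closure of
the simple curves -/

section Law

open Literature.Probability.RandomPlanarGeometry.SAW.YangBaxter

/-- **Under the Yang–Baxter law with `a ≠ b`, `δ ≠ 0`, every sample curve is simple**: the
pushed-forward law gives the event `CurveClass.simple` full mass. [folklore] -/
theorem map_ybLaw_simple_eq (Ω : Set ℂ) {δ : ℝ} (hδ : δ ≠ 0) (x : ℝ) {a b : MidEdge}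
    (hab : a ≠ b) :
    (ybLaw (fun (_ : ℤ) => Real.pi / 2) Ω δ x a b).map
        (fun γ => γ.curve (fun (_ : ℤ) => Real.pi / 2) δ) CurveClass.simple =
      ybLaw (fun (_ : ℤ) => Real.pi / 2) Ω δ x a b Set.univ := by
  rw [Measure.map_apply (YBWalk.measurable_of_top _) CurveClass.measurableSet_simple']
  congr 1
  ext γ
  simp only [Set.mem_preimage, Set.mem_univ, iff_true]
  exact curve_mem_simple γ hab hδ

/-- **Subsequential limits are carried by the closure of the simple curves (the SOFT half of stub
I2b).** Every probability subsequential weak limit `ν`, along mesh sequences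
`s_n → 0⁺`, of the curve laws of Glazman–Manolescu's critical `π/2` Yang–Baxter walk in a
Dobrushin domain (any port endpoint approximation) is carried by the CLOSURE of the simple curve
classes: `ν(closure CurveClass.simple) = 1`. (Portmanteau on the closed set
`closure CurveClass.simple`, which has lattice probability `1` as soon as `a (s n) ≠ b (s n)` and
`s n > 0`, by `curve_mem_simple`.) What is left of I2b is exactly `ν(closure simple ∖ simple) = 0`
— no self-touching of the limit, the uniform no-fjord estimate. [folklore] -/
theorem subseqLimit_closure_simple :
    ∀ (D : DobrushinDomain) (a b : ℝ → MidEdge),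
      IsYBEndpointApprox (fun (_ : ℤ) => Real.pi / 2) D a b →
      ∀ (s : ℕ → ℝ) (ν : Measure (CurveClass ℂ)), Tendsto s atTop (𝓝[>] (0 : ℝ)) →
        IsProbabilityMeasure ν →
        (∀ f : BoundedContinuousFunction (CurveClass ℂ) ℝ,
          Tendsto (fun n => ∫ γ, f (γ.curve (fun (_ : ℤ) => Real.pi / 2) (s n))
              ∂(ybLaw (fun (_ : ℤ) => Real.pi / 2) D.carrier (s n) 1 (a (s n)) (b (s n))))
            atTop (𝓝 (∫ x, f x ∂ν))) →
        ∀ᵐ γ ∂ν, γ ∈ closure (CurveClass.simple : Set (CurveClass ℂ)) := by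
  -- adapted from `stub_ybSubseqLimitChordal` (Theorems/SAWCompassLatticeCompassSLEYbSubseqLimitChordal)
  intro D a b hab s ν hs hν hlim
  classical
  set Θ : ℤ → ℝ := fun _ => Real.pi / 2 with hΘ
  set P : ℕ → Measure (CurveClass ℂ) := fun n =>
    (ybLaw Θ D.carrier (s n) 1 (a (s n)) (b (s n))).map (fun γ => γ.curve Θ (s n)) with hP
  have hmeas : ∀ n, Measurable
      (fun γ : YangBaxterSAW Θ D.carrier (s n) (a (s n)) (b (s n)) => γ.curve Θ (s n)) :=
    fun n => YBWalk.measurable_of_top _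
  have hweakP : ∀ f : BoundedContinuousFunction (CurveClass ℂ) ℝ,
      Tendsto (fun n => ∫ x, f x ∂(P n)) atTop (𝓝 (∫ x, f x ∂ν)) := fun f => by
    have hint : ∀ n, ∫ x, f x ∂(P n) =
        ∫ γ, f (γ.curve Θ (s n)) ∂(ybLaw Θ D.carrier (s n) 1 (a (s n)) (b (s n))) := fun n =>
      integral_map (hmeas n).aemeasurable f.continuous.aestronglyMeasurable
    simp only [hint]
    exact hlim f
  have hmass01 : ∀ n, P n univ = 0 ∨ P n univ = 1 := fun n => by
    simp only [hP]
    rw [Measure.map_apply (hmeas n) MeasurableSet.univ, preimage_univ, ybLaw, Measure.smul_apply,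
      smul_eq_mul]
    by_cases h0 : ybWeight Θ D.carrier (s n) 1 (a (s n)) (b (s n)) univ = 0
    · left
      rw [h0, mul_zero]
    by_cases ht : ybWeight Θ D.carrier (s n) 1 (a (s n)) (b (s n)) univ = ∞
    · left
      rw [ht, ENNReal.inv_top, zero_mul]
    · right
      exact ENNReal.inv_mul_cancel h0 ht
  have hevP : ∀ᶠ n in atTop, IsProbabilityMeasure (P n) := by
    have h := hweakP (BoundedContinuousFunction.const (CurveClass ℂ) (1 : ℝ))
    simp only [BoundedContinuousFunction.const_apply, integral_const, smul_eq_mul, mul_one,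
      probReal_univ] at h
    have hev : ∀ᶠ n in atTop, (1 / 2 : ℝ) < (P n).real univ := h.eventually (lt_mem_nhds (by norm_num))
    filter_upwards [hev] with n hn
    rcases hmass01 n with h0 | h1
    · exfalso
      rw [measureReal_def, h0, ENNReal.toReal_zero] at hn
      linarith
    · exact ⟨h1⟩
  let Q : ℕ → ProbabilityMeasure (CurveClass ℂ) := fun n =>
    if h : IsProbabilityMeasure (P n) then ⟨P n, h⟩ else ⟨ν, hν⟩
  have hQP : ∀ᶠ n in atTop, (Q n : Measure (CurveClass ℂ)) = P n := by
    filter_upwards [hevP] with n hn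
    simp only [Q, dif_pos hn, ProbabilityMeasure.coe_mk]
  have hQlim : Tendsto Q atTop (𝓝 (⟨ν, hν⟩ : ProbabilityMeasure (CurveClass ℂ))) := by
    rw [ProbabilityMeasure.tendsto_iff_forall_integral_tendsto]
    intro f
    refine (hweakP f).congr' ?_
    filter_upwards [hQP] with n hn
    rw [hn]
  have hclosed : ∀ C : Set (CurveClass ℂ), IsClosed C → (∀ᶠ n in atTop, P n C = 1) → ν C = 1 := by
    intro C hC hPC
    have h := ProbabilityMeasure.limsup_measure_closed_le_of_tendsto hQlim hC
    have heq : (fun n => (Q n : Measure (CurveClass ℂ)) C) =ᶠ[atTop] fun _ => (1 : ℝ≥0∞) := by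
      filter_upwards [hQP, hPC] with n hn hn'
      rw [hn, hn']
    rw [limsup_congr heq, limsup_const] at h
    exact le_antisymm prob_le_one h
  -- eventually `a (s n) ≠ b (s n)` and `0 < s n`
  have hab' : D.pt 0 ≠ D.pt 1 := fun h => absurd (D.pt_injective h) (by decide)
  have hfst : Tendsto (fun n => ((s n : ℝ) : ℂ) * planeMidpoint Θ (a (s n))) atTop (𝓝 (D.pt 0)) :=
    hab.tendsto_fst.comp hs
  have hsnd : Tendsto (fun n => ((s n : ℝ) : ℂ) * planeMidpoint Θ (b (s n))) atTop (𝓝 (D.pt 1)) :=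
    hab.tendsto_snd.comp hs
  have hne : ∀ᶠ n in atTop, a (s n) ≠ b (s n) := by
    have hd : 0 < dist (D.pt 0) (D.pt 1) / 2 := half_pos (dist_pos.2 hab')
    filter_upwards [hfst.eventually (ball_mem_nhds _ hd), hsnd.eventually (ball_mem_nhds _ hd)]
      with n ha hb h
    rw [h] at ha
    have := dist_triangle_left (D.pt 0) (D.pt 1) (((s n : ℝ) : ℂ) * planeMidpoint Θ (b (s n)))
    linarith
  have hpos : ∀ᶠ n in atTop, 0 < s n := hs.eventually (self_mem_nhdsWithin)
  -- the closed event `closure simple` has lattice probability one eventually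
  have hPC : ∀ᶠ n in atTop, P n (closure CurveClass.simple) = 1 := by
    filter_upwards [hevP, hne, hpos] with n hn hne' hpos'
    haveI := hn
    have : P n (closure CurveClass.simple) = P n univ := by
      simp only [hP]
      rw [Measure.map_apply (hmeas n) isClosed_closure.measurableSet,
        Measure.map_apply (hmeas n) MeasurableSet.univ]
      congr 1
      ext γ
      simp only [mem_preimage, preimage_univ, mem_univ, iff_true]
      exact subset_closure (curve_mem_simple γ hne' hpos'.ne')
    rw [this]
    exact measure_univ
  have hν : ν (closure CurveClass.simple) = 1 := hclosed _ isClosed_closure hPC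
  rw [ae_iff]
  rw [← prob_compl_eq_zero_iff isClosed_closure.measurableSet] at hν
  simpa [Set.compl_def] using hν

end Law

end LatticeSimple

open Literature.Probability.RandomPlanarGeometry.SAW.YangBaxter in
/-- **Registered piece `stub_ybSubseqLimitClosureSimple` of the `CompassSLE` skeleton
(`Cruxes/CompassSLE/Lines/birth.lean`; the SOFT half of the open stub I2b
`stub_ybSubseqLimitSimple`).** Every probability subsequential weak limit, along mesh sequences
`s_n → 0⁺`, of the curve laws of Glazman–Manolescu's critical `π/2` Yang–Baxter walk in a Dobrushin
domain is carried by `closure CurveClass.simple`; what is left of I2b is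
`ν (closure simple ∖ simple) = 0` (no self-touching of the limit). [folklore] -/
theorem stub_ybSubseqLimitClosureSimple :
    ∀ (D : DobrushinDomain) (a b : ℝ → MidEdge),
      IsYBEndpointApprox (fun (_ : ℤ) => Real.pi / 2) D a b →
      ∀ (s : ℕ → ℝ) (ν : Measure (CurveClass ℂ)), Tendsto s atTop (𝓝[>] (0 : ℝ)) →
        IsProbabilityMeasure ν →
        (∀ f : BoundedContinuousFunction (CurveClass ℂ) ℝ,
          Tendsto (fun n => ∫ γ, f (γ.curve (fun (_ : ℤ) => Real.pi / 2) (s n))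
              ∂(ybLaw (fun (_ : ℤ) => Real.pi / 2) D.carrier (s n) 1 (a (s n)) (b (s n))))
            atTop (𝓝 (∫ x, f x ∂ν))) →
        ∀ᵐ γ ∂ν, γ ∈ closure (CurveClass.simple : Set (CurveClass ℂ)) :=
  LatticeSimple.subseqLimit_closure_simple

end Summit.CriticalPhenomena.SAWScalingLimit.Theorems.SAWCompassLatticeCompassSLE

end
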